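import Literature.NumberTheory.EllipticCurves.BinaryQuarticJacobian
import Literature.NumberTheory.EllipticCurves.BinaryQuarticActionDeterminant
import HarnessLib

/-!
# Section-independence of the Jacobian in Bhargava–Shankar, Props. 2.7–2.8: the key polynomial identity

Topic `Literature/NumberTheory/EllipticCurves`; companion of `BinaryQuarticJacobian.lean` (the
infinitesimal action `lieDeriv X f = (d/dε) f ∘ (1 + εX)|_{ε=0}` of `M₂(R)` on the space `V_R` of
binary quartic forms, and the value `2/27` of the Jacobian of `Ψ : (g, I, J) ↦ g · q_{I,J}` at
`g = 1` for the particular section `q_{I,J} = x³y − (I/3)xy³ − (J/27)y⁴`) and of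
`BinaryQuarticActionDeterminant.lean` (the matrix `actionMatrix γ` of `f ↦ f ∘ γ`).

Source: M. Bhargava, A. Shankar, *Binary quartic forms having bounded invariants, and the
boundedness of the average rank of elliptic curves*, Ann. of Math. (2) 181 (2015) 191–242, §2.4,
Props. 2.7–2.8 of the held arXiv text `arXiv:1006.1002v2`. Prop. 2.8 asserts that the Jacobian
identity `(2/(27 n)) ∫_R ∫_{SL₂} φ(g · p_{I,J}) dg dI dJ = ∫_V φ` holds for *every* measurable
section `R = {p_{I,J}}` of the invariant map `(I, J)`, and proves it from the case `R = R₀ =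
{q_{I,J}}` ("can be checked directly ... via a Jacobian computation") by transport along
`g_{I,J} · p_{I,J} = q_{I,J}` and unimodularity of `SL₂`. This file proves the pointwise algebraic
statement underlying that section-independence, in a form usable for any differentiable section and
at any group element (no unimodularity needed):

* `BinaryQuartic.dI f w`, `BinaryQuartic.dJ f w` — the differentials of the invariants `I`, `J` at
  `f` in the direction `w` (exact Taylor expansions `I_add_smul_dI`, `J_add_smul_dJ`; the same polarisations appear, written out, in `BinaryQuarticDiscriminantFirstOrderProofs.I_add_smul`/`J_add_smul`), with the
  infinitesimal relative invariance `dI_f(ℒ_X f) = 4 tr(X) I(f)`, `dJ_f(ℒ_X f) = 6 tr(X) J(f)`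
  (`dI_lieDeriv`, `dJ_lieDeriv`; from `I(γ · f) = (det γ)⁴ I(f)`, `J(γ · f) = (det γ)⁶ J(f)`).
* linearity of `lieDeriv X f` in `X` and in `f`, `lieDeriv 1 f = 4f`, and the closed forms of
  `ℒ_e f`, `ℒ_h f`, `ℒ_f f` for `e = (0 1; 0 0)`, `h = (1 0; 0 −1)`, `f = (0 0; 1 0)`
  (`coeffs_lieDeriv_e/h/f`).
* **equivariance** `det(γ) · (ℒ_X f) ∘ γ = ℒ_{γ X adj(γ)} (f ∘ γ)` (`det_smul_lieDeriv_subst`), i.e.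
  `A(γ) ℒ_X A(γ)⁻¹ = ℒ_{γXγ⁻¹}` for invertible `γ`.
* **the key identity** (`det_rows_lieDeriv`): for every form `f` and all `w₁, w₂ ∈ V_R`,
  `27 · det[w₁; w₂; ℒ_e f; ℒ_h f; ℒ_f f] = 2 · (dI_f(w₁) dJ_f(w₂) − dI_f(w₂) dJ_f(w₁))`
  (rows in the coordinates `(a, b, c, d, e)`). Consequently, for ANY family `p(α, β)` of forms
  whose invariants are `(I(α,β), J(α,β))`, the determinant of
  `[∂_α p; ∂_β p; ℒ_e p; ℒ_h p; ℒ_f p]` is `(2/27) · ∂(I,J)/∂(α,β)` (chain rule), which is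
  Bhargava–Shankar's constant `2/27` (`det_jacobianMatrix`) for the section `q_{I,J}` and explains
  why it does not depend on the section (Prop. 2.8).

Everything here is exact algebra over a commutative ring (theorems only; no named facts).

## References

* [BhargavaShankarAnnals2015] M. Bhargava, A. Shankar, Ann. of Math. (2) 181 (2015) 191–242,
  Props. 2.7–2.8 (arXiv:1006.1002v2 numbering). [cite: BhargavaShankarAnnals2015, Props. 2.7–2.8 (section independence of the Jacobian; arXiv:1006.1002v2 numbering)]

## Design

The `5 × 5` determinant is expanded along rows by `Matrix.det_succ_row_zero` keeping all indices
in `Fin.succ`-normal form (`Fin.succ_succAbove_succ` etc.), after which `ring` closes the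
polynomial identity; the generic rows are placed first.
-/

noncomputable section

namespace Literature.NumberTheory.EllipticCurves

namespace BinaryQuartic

variable {R : Type*} [CommRing R]

/-! ## Linearity of the infinitesimal action -/

/-- `ℒ_{X+Y} f = ℒ_X f + ℒ_Y f`. [folklore] -/
theorem lieDeriv_add_left (X Y : Matrix (Fin 2) (Fin 2) R) (f : BinaryQuartic R) :
    lieDeriv (X + Y) f = lieDeriv X f + lieDeriv Y f := by
  ext <;> simp [lieDeriv] <;> ring

/-- `ℒ_{cX} f = c ℒ_X f`. [folklore] -/
theorem lieDeriv_smul_left (c : R) (X : Matrix (Fin 2) (Fin 2) R) (f : BinaryQuartic R) :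
    lieDeriv (c • X) f = c • lieDeriv X f := by
  ext <;> simp [lieDeriv] <;> ring

/-- `ℒ_{−X} f = −1 · ℒ_X f` (as `V_R` carries only `+` and scalar multiplication). [folklore] -/
theorem lieDeriv_neg_left (X : Matrix (Fin 2) (Fin 2) R) (f : BinaryQuartic R) :
    lieDeriv (-X) f = (-1 : R) • lieDeriv X f := by
  ext <;> simp [lieDeriv] <;> ring

/-- `ℒ_X (f + g) = ℒ_X f + ℒ_X g`. [folklore] -/
theorem lieDeriv_add_right (X : Matrix (Fin 2) (Fin 2) R) (f g : BinaryQuartic R) :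
    lieDeriv X (f + g) = lieDeriv X f + lieDeriv X g := by
  ext <;> simp [lieDeriv] <;> ring

/-- `ℒ_X (c f) = c ℒ_X f`. [folklore] -/
theorem lieDeriv_smul_right (X : Matrix (Fin 2) (Fin 2) R) (c : R) (f : BinaryQuartic R) :
    lieDeriv X (c • f) = c • lieDeriv X f := by
  ext <;> simp [lieDeriv] <;> ring

/-- The centre acts by the degree: `ℒ_1 f = 4 f` (`f ∘ (1 + ε) = (1 + ε)⁴ f`). [folklore] -/
theorem lieDeriv_one (f : BinaryQuartic R) : lieDeriv 1 f = (4 : R) • f := by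
  ext <;> simp [lieDeriv] <;> ring

/-- `ℒ_e f = (b, 2c, 3d, 4e, 0)` for `e = (0 1; 0 0)`. [cite: BhargavaShankarAnnals2015, Props. 2.7–2.8 (arXiv:1006.1002v2 numbering)] -/
theorem coeffs_lieDeriv_e (f : BinaryQuartic R) :
    (lieDeriv !![0, 1; 0, 0] f).coeffs = ![f.b, 2 * f.c, 3 * f.d, 4 * f.e, 0] := by
  ext i
  fin_cases i <;> simp [coeffs, lieDeriv, mul_comm]

/-- `ℒ_h f = (4a, 2b, 0, −2d, −4e)` for `h = (1 0; 0 −1)`. [cite: BhargavaShankarAnnals2015, Props. 2.7–2.8 (arXiv:1006.1002v2 numbering)] -/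
theorem coeffs_lieDeriv_h (f : BinaryQuartic R) :
    (lieDeriv !![1, 0; 0, -1] f).coeffs = ![4 * f.a, 2 * f.b, 0, -2 * f.d, -4 * f.e] := by
  ext i
  fin_cases i <;> simp [coeffs, lieDeriv] <;> ring

/-- `ℒ_f f' = (0, 4a, 3b, 2c, d)` for `f = (0 0; 1 0)`. [cite: BhargavaShankarAnnals2015, Props. 2.7–2.8 (arXiv:1006.1002v2 numbering)] -/
theorem coeffs_lieDeriv_f (f : BinaryQuartic R) :
    (lieDeriv !![0, 0; 1, 0] f).coeffs = ![0, 4 * f.a, 3 * f.b, 2 * f.c, f.d] := by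
  ext i
  fin_cases i <;> simp [coeffs, lieDeriv]

/-! ## Equivariance under the action -/

/-- **Equivariance of the infinitesimal action**: `det(γ) · (ℒ_X f) ∘ γ = ℒ_{γ X adj(γ)} (f ∘ γ)`;
for invertible `γ` (where `adj(γ) = det(γ) γ⁻¹`) this is `(ℒ_X f) ∘ γ = ℒ_{γXγ⁻¹}(f ∘ γ)`, i.e.
`A(γ) ℒ_X = ℒ_{Ad(γ)X} A(γ)` — differentiate `γ (1 + εX) = (1 + ε γXγ⁻¹) γ`. [folklore] -/
theorem det_smul_lieDeriv_subst (X γ : Matrix (Fin 2) (Fin 2) R) (f : BinaryQuartic R) :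
    γ.det • (lieDeriv X f).subst γ = lieDeriv (γ * X * γ.adjugate) (f.subst γ) := by
  ext <;> simp [lieDeriv, subst, Matrix.adjugate_fin_two, Matrix.det_fin_two, Matrix.mul_apply,
    Fin.sum_univ_two] <;> ring

/-! ## The differentials of `I` and `J` -/

/-- The differential of `I` at `f` in the direction `w`: `dI_f(w) = 12(a w_e + e w_a) − 3(b w_d +
d w_b) + 2 c w_c` (`I = 12ae − 3bd + c²`). [folklore] -/
def dI (f w : BinaryQuartic R) : R :=
  12 * (f.a * w.e + f.e * w.a) - 3 * (f.b * w.d + f.d * w.b) + 2 * f.c * w.c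

/-- The differential of `J` at `f` in the direction `w` (`J = 72ace + 9bcd − 27ad² − 27eb² − 2c³`).
[folklore] -/
def dJ (f w : BinaryQuartic R) : R :=
  72 * (w.a * f.c * f.e + f.a * w.c * f.e + f.a * f.c * w.e)
    + 9 * (w.b * f.c * f.d + f.b * w.c * f.d + f.b * f.c * w.d)
    - 27 * (w.a * f.d ^ 2 + 2 * f.a * f.d * w.d) - 27 * (w.e * f.b ^ 2 + 2 * f.e * f.b * w.b)
    - 6 * f.c ^ 2 * w.c

/-- Exact Taylor expansion of the quadratic invariant: `I(f + t w) = I(f) + t dI_f(w) + t² I(w)`.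
[folklore] -/
theorem I_add_smul_dI (f w : BinaryQuartic R) (t : R) :
    (f + t • w).I = f.I + t * dI f w + t ^ 2 * w.I := by
  simp only [I, dI, add_a, add_b, add_c, add_d, add_e, smul_a, smul_b, smul_c, smul_d, smul_e]
  ring

/-- Exact Taylor expansion of the cubic invariant: `J(f + t w) = J(f) + t dJ_f(w) + t² dJ_w(f) +
t³ J(w)`. [folklore] -/
theorem J_add_smul_dJ (f w : BinaryQuartic R) (t : R) :
    (f + t • w).J = f.J + t * dJ f w + t ^ 2 * dJ w f + t ^ 3 * w.J := by
  simp only [J, dJ, add_a, add_b, add_c, add_d, add_e, smul_a, smul_b, smul_c, smul_d, smul_e]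
  ring

/-- Euler's identity for the quadratic `I`: `dI_f(f) = 2 I(f)`. [folklore] -/
theorem dI_self (f : BinaryQuartic R) : dI f f = 2 * f.I := by
  simp only [dI, I]; ring

/-- Euler's identity for the cubic `J`: `dJ_f(f) = 3 J(f)`. [folklore] -/
theorem dJ_self (f : BinaryQuartic R) : dJ f f = 3 * f.J := by
  simp only [dJ, J]; ring

/-- `dI_f` is additive in the direction. [folklore] -/
theorem dI_add (f v w : BinaryQuartic R) : dI f (v + w) = dI f v + dI f w := by
  simp only [dI, add_a, add_b, add_c, add_d, add_e]; ring

/-- `dI_f` is homogeneous in the direction. [folklore] -/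
theorem dI_smul (f w : BinaryQuartic R) (c : R) : dI f (c • w) = c * dI f w := by
  simp only [dI, smul_a, smul_b, smul_c, smul_d, smul_e]; ring

/-- `dJ_f` is additive in the direction. [folklore] -/
theorem dJ_add (f v w : BinaryQuartic R) : dJ f (v + w) = dJ f v + dJ f w := by
  simp only [dJ, add_a, add_b, add_c, add_d, add_e]; ring

/-- `dJ_f` is homogeneous in the direction. [folklore] -/
theorem dJ_smul (f w : BinaryQuartic R) (c : R) : dJ f (c • w) = c * dJ f w := by
  simp only [dJ, smul_a, smul_b, smul_c, smul_d, smul_e]; ring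

/-- **Infinitesimal relative invariance of `I`**: `dI_f(ℒ_X f) = 4 tr(X) I(f)` (from
`I(f ∘ (1 + εX)) = det(1 + εX)⁴ I(f) = (1 + 4ε tr X) I(f)`); in particular the orbit directions of
`𝔰𝔩₂` are tangent to the level sets of `I`. [cite: BhargavaShankarAnnals2015, §2 p. 8 (I(γ·f) = (det γ)⁴ I(f))] -/
theorem dI_lieDeriv (X : Matrix (Fin 2) (Fin 2) R) (f : BinaryQuartic R) :
    dI f (lieDeriv X f) = 4 * (X 0 0 + X 1 1) * f.I := by
  simp only [dI, lieDeriv, I]; ring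

/-- **Infinitesimal relative invariance of `J`**: `dJ_f(ℒ_X f) = 6 tr(X) J(f)`. [cite: BhargavaShankarAnnals2015, §2 p. 8 (J(γ·f) = (det γ)⁶ J(f))] -/
theorem dJ_lieDeriv (X : Matrix (Fin 2) (Fin 2) R) (f : BinaryQuartic R) :
    dJ f (lieDeriv X f) = 6 * (X 0 0 + X 1 1) * f.J := by
  simp only [dJ, lieDeriv, J]; ring

/-! ## The key identity -/

/-- The `5 × 5` determinant with two arbitrary rows followed by the rows `ℒ_e f, ℒ_h f, ℒ_f f`,
as an explicit polynomial: `27 · det = 2 · (dI_f(p) dJ_f(q) − dI_f(q) dJ_f(p))` written out in the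
coordinates of `p` and `q`. [folklore] -/
theorem det_rows_lieDeriv_explicit (f : BinaryQuartic R) (p0 p1 p2 p3 p4 q0 q1 q2 q3 q4 : R) :
    27 * (Matrix.of ![![p0, p1, p2, p3, p4], ![q0, q1, q2, q3, q4],
        ![f.b, 2 * f.c, 3 * f.d, 4 * f.e, 0], ![4 * f.a, 2 * f.b, 0, -2 * f.d, -4 * f.e],
        ![0, 4 * f.a, 3 * f.b, 2 * f.c, f.d]]).det =
      2 * ((12 * (f.a * p4 + f.e * p0) - 3 * (f.b * p3 + f.d * p1) + 2 * f.c * p2) *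
            (72 * (q0 * f.c * f.e + f.a * q2 * f.e + f.a * f.c * q4)
              + 9 * (q1 * f.c * f.d + f.b * q2 * f.d + f.b * f.c * q3)
              - 27 * (q0 * f.d ^ 2 + 2 * f.a * f.d * q3)
              - 27 * (q4 * f.b ^ 2 + 2 * f.e * f.b * q1) - 6 * f.c ^ 2 * q2)
          - (12 * (f.a * q4 + f.e * q0) - 3 * (f.b * q3 + f.d * q1) + 2 * f.c * q2) *
            (72 * (p0 * f.c * f.e + f.a * p2 * f.e + f.a * f.c * p4)
              + 9 * (p1 * f.c * f.d + f.b * p2 * f.d + f.b * f.c * p3)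
              - 27 * (p0 * f.d ^ 2 + 2 * f.a * f.d * p3)
              - 27 * (p4 * f.b ^ 2 + 2 * f.e * f.b * p1) - 6 * f.c ^ 2 * p2)) := by
  simp only [Matrix.det_succ_row_zero, Matrix.det_isEmpty, Fin.sum_univ_succ, Fin.sum_univ_zero,
    Matrix.submatrix_apply, Matrix.of_apply, Matrix.cons_val_zero, Matrix.cons_val_succ,
    Fin.zero_succAbove, Fin.succ_succAbove_zero, Fin.succ_succAbove_succ, Fin.val_zero,
    Fin.val_succ, pow_zero, pow_succ]
  ring

/-- **Section independence of the Jacobian (Bhargava–Shankar, Props. 2.7–2.8), pointwise form.**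
For every binary quartic form `f` and all `w₁, w₂ ∈ V_R`,
`27 · det[w₁; w₂; ℒ_e f; ℒ_h f; ℒ_f f] = 2 · (dI_f(w₁) dJ_f(w₂) − dI_f(w₂) dJ_f(w₁))`
(rows written in the coordinates `(a, b, c, d, e)`). Hence for any differentiable family
`p(α, β)` with invariants `(I(α, β), J(α, β))` the determinant of the differential of
`(g, α, β) ↦ g · p(α, β)` at `g = 1` is `(2/27) ∂(I, J)/∂(α, β)`, independently of the family —
for `q_{I,J}` this is the `2/27` of `det_jacobianMatrix`. [cite: BhargavaShankarAnnals2015, Props. 2.7–2.8 (arXiv:1006.1002v2 numbering)] -/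
theorem det_rows_lieDeriv (f w₁ w₂ : BinaryQuartic R) :
    27 * (Matrix.of ![w₁.coeffs, w₂.coeffs, (lieDeriv !![0, 1; 0, 0] f).coeffs,
        (lieDeriv !![1, 0; 0, -1] f).coeffs, (lieDeriv !![0, 0; 1, 0] f).coeffs]).det =
      2 * (dI f w₁ * dJ f w₂ - dI f w₂ * dJ f w₁) := by
  rw [coeffs_lieDeriv_e, coeffs_lieDeriv_h, coeffs_lieDeriv_f]
  have h := det_rows_lieDeriv_explicit f w₁.a w₁.b w₁.c w₁.d w₁.e w₂.a w₂.b w₂.c w₂.d w₂.e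
  simp only [coeffs] at h ⊢
  rw [h]
  simp only [dI, dJ]

/-- The key identity over a field of characteristic `0`:
`det[w₁; w₂; ℒ_e f; ℒ_h f; ℒ_f f] = (2/27)(dI_f(w₁) dJ_f(w₂) − dI_f(w₂) dJ_f(w₁))`.
[cite: BhargavaShankarAnnals2015, Props. 2.7–2.8 (arXiv:1006.1002v2 numbering)] -/
theorem det_rows_lieDeriv_eq {K : Type*} [Field K] [CharZero K] (f w₁ w₂ : BinaryQuartic K) :
    (Matrix.of ![w₁.coeffs, w₂.coeffs, (lieDeriv !![0, 1; 0, 0] f).coeffs,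
        (lieDeriv !![1, 0; 0, -1] f).coeffs, (lieDeriv !![0, 0; 1, 0] f).coeffs]).det =
      2 / 27 * (dI f w₁ * dJ f w₂ - dI f w₂ * dJ f w₁) := by
  have h := det_rows_lieDeriv f w₁ w₂
  have h27 : (27 : K) ≠ 0 := by norm_num
  apply mul_left_cancel₀ h27
  rw [h]
  field_simp

end BinaryQuartic

end Literature.NumberTheory.EllipticCurves

end
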